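import Literature.RingTheory.CompleteLocalRings.WittVectorLifts
import Literature.RingTheory.Etale.GenericFiniteEtale
import Mathlib.RingTheory.AlgebraicIndependent.TranscendenceBasis
import Mathlib.RingTheory.Ideal.GoingUp
import Mathlib.FieldTheory.IsAlgClosed.Basic
import Mathlib.Algebra.MvPolynomial.Funext
import HarnessLib

/-!
# Cassels' embedding theorem, Witt-vector form: finitely generated domains of characteristic zero embed in `W(κ)`

Topic `Literature/RingTheory/CompleteLocalRings`. J. W. S. Cassels, *An embedding theorem for
fields*, Bull. Austral. Math. Soc. 14 (1976) 193–198, Thm. I: a finitely generated field of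
characteristic zero embeds in `ℚ_p` for infinitely many primes `p` (with any prescribed finite set
landing in the `p`-adic units); equivalently, a finitely generated integral domain `R ⊇ ℤ` embeds
in `ℤ_p` for infinitely many `p`. We prove the version with `ℤ_p` replaced by the Witt ring `W(κ)`
of an ALGEBRAICALLY CLOSED field `κ` of characteristic `p` (e.g. `W(𝔽̄_p)`, the ring of integers of
the completed maximal unramified extension of `ℚ_p`), in which the conclusion holds for ALL
sufficiently large primes `p`:

* `exists_injective_ringHom_wittVector` — for `R` an integral domain of characteristic zero of
  finite type over `ℤ` there is `N₀` such that for every prime `p ≥ N₀` and every algebraically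
  closed field `κ` of characteristic `p` there is an INJECTIVE ring map `R → W(κ)`.

Proof (Cassels' argument): choose a transcendence basis `y₁,…,y_d ∈ R` over `ℤ`, so `R` is
algebraic over `B = ℤ[y]`; for some `c ≠ 0`, `R[1/c]` is integral over `B[1/c]`
(`Etale.exists_isIntegral_away`) and for some `f ≠ 0`, `R[1/c][1/f]` is étale over `B[1/c]`
(`Etale.exists_etale_away`); a monic equation for `f` yields `b₀ ∈ B[1/c]`, `b₀ ≠ 0`, with
`b₀ ∈ f·R[1/c]`. For `p` not dividing a fixed non-zero integer coefficient of the polynomial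
`c·b` (`b` the numerator of `b₀`) and `κ` algebraically closed of characteristic `p`: pick `a ∈ κ^d`
with `(c·b)(a) ≠ 0` (`κ` is infinite), lift `a` to `u ∈ W(κ)^d` algebraically independent over `ℤ`
(`CompleteLocalRings.exists_algebraicIndependent_lift_wittVector`), so that `y ↦ u` is an injective
map `B[1/c] → W(κ)`; by lying-over there is a point `R[1/c] → κ` over `y ↦ a` not killing `f`
(`exists_ringHom_comp_eq_of_isIntegral`), i.e. a `κ`-point of the étale `B[1/c]`-algebra
`R[1/c][1/f]`, which lifts to a `B[1/c]`-algebra map `R[1/c][1/f] → W(κ)` (Hensel: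
`CompleteLocalRings.exists_algHom_wittVector_of_formallySmooth`); its kernel on `R[1/c]` meets
`B[1/c]` in `0`, hence is `0` by incomparability (`R[1/c]` is integral over `B[1/c]`), and
`R → R[1/c] → W(κ)` is injective.

## References

* [Cassels1976] J. W. S. Cassels, An embedding theorem for fields, Bull. Austral. Math. Soc. 14
  (1976) 193–198, Thm. I.
* [Cassels1986] J. W. S. Cassels, Local Fields, LMS Student Texts 3, CUP 1986, Ch. 5 Thm. 1.1.
-/

noncomputable section

universe u v

namespace Literature.RingTheory.CompleteLocalRings

open Literature.RingTheory.Etale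

/-! ## Points of an integral extension over a prescribed point of the base -/

/-- **A point over a prescribed point, avoiding a hypersurface.** Let `Bc ⊆ Rc` be an integral
extension with `Rc` a domain, `κ` an algebraically closed field, `ψ : Bc → κ` a ring map, and
`f ∈ Rc`, `b₀ ∈ Bc` with `b₀ ∈ f·Rc` and `ψ(b₀) ≠ 0`. Then there is a ring map `x : Rc → κ`
extending `ψ` with `x(f) ≠ 0`: by lying-over (Mathlib `Ideal.exists_ideal_over_prime_of_isIntegral`)
a prime `Q` of `Rc` lies over `ker ψ`, it cannot contain `f` (else `b₀ ∈ Q ∩ Bc = ker ψ`), and the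
integral domain extension `Bc/ker ψ ⊆ Rc/Q` embeds into `κ` over `ψ` (`IsAlgClosed.lift`), the
embedding being injective by incomparability. (Cassels 1976, proof of Thm. I: the root `θ̄` of
`H(a, Y)` modulo `p` with `Δ(a) ≢ 0`.) [cite: Cassels1976, proof of Thm. I] -/
theorem exists_ringHom_comp_eq_of_isIntegral {Bc Rc κ : Type*} [CommRing Bc] [CommRing Rc]
    [Algebra Bc Rc] [IsDomain Rc] [FaithfulSMul Bc Rc] [Algebra.IsIntegral Bc Rc] [Field κ]
    [IsAlgClosed κ] (ψ : Bc →+* κ) {f : Rc} {b₀ : Bc}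
    (hb₀ : algebraMap Bc Rc b₀ ∈ Ideal.span {f}) (hψ : ψ b₀ ≠ 0) :
    ∃ x : Rc →+* κ, x.comp (algebraMap Bc Rc) = ψ ∧ x f ≠ 0 := by
  haveI : IsDomain Bc := (FaithfulSMul.algebraMap_injective Bc Rc).isDomain _
  set 𝔭 : Ideal Bc := RingHom.ker ψ with h𝔭
  haveI : 𝔭.IsPrime := RingHom.ker_isPrime ψ
  obtain ⟨Q, -, hQ, hQc⟩ := Ideal.exists_ideal_over_prime_of_isIntegral 𝔭 (⊥ : Ideal Rc)
    (Ideal.comap_bot_le_of_injective _ (FaithfulSMul.algebraMap_injective Bc Rc))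
  haveI := hQ
  haveI : Q.LiesOver 𝔭 := ⟨hQc.symm⟩
  -- `f ∉ Q`
  have hfQ : f ∉ Q := by
    intro hfQ
    have h1 : algebraMap Bc Rc b₀ ∈ Q := (Ideal.span_singleton_le_iff_mem Q).2 hfQ hb₀
    have h2 : b₀ ∈ 𝔭 := by rw [← hQc]; exact h1
    exact hψ h2
  -- `κ` as a `Bc/𝔭`-algebra, injectively
  letI : Algebra (Bc ⧸ 𝔭) κ := (RingHom.kerLift ψ).toAlgebra
  haveI : FaithfulSMul (Bc ⧸ 𝔭) κ :=
    (faithfulSMul_iff_algebraMap_injective _ _).2 (RingHom.kerLift_injective ψ)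
  haveI : Algebra.IsAlgebraic (Bc ⧸ 𝔭) (Rc ⧸ Q) := Algebra.IsIntegral.isAlgebraic
  let L : (Rc ⧸ Q) →ₐ[Bc ⧸ 𝔭] κ := IsAlgClosed.lift
  -- `L` is injective (incomparability)
  have hL : Function.Injective L := by
    rw [injective_iff_map_eq_zero]
    intro z hz
    have hker : RingHom.ker (L : (Rc ⧸ Q) →+* κ) = ⊥ := by
      haveI : (RingHom.ker (L : (Rc ⧸ Q) →+* κ)).IsPrime := RingHom.ker_isPrime _
      refine Ideal.eq_bot_of_comap_eq_bot (R := Bc ⧸ 𝔭) ?_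
      refine eq_bot_iff.2 fun r hr => ?_
      rw [Ideal.mem_comap, RingHom.mem_ker, AlgHom.coe_toRingHom, AlgHom.commutes] at hr
      exact (Ideal.mem_bot).2 ((injective_iff_map_eq_zero _).1 (RingHom.kerLift_injective ψ) r hr)
    have : z ∈ RingHom.ker (L : (Rc ⧸ Q) →+* κ) := hz
    rwa [hker, Ideal.mem_bot] at this
  refine ⟨(L : (Rc ⧸ Q) →+* κ).comp (Ideal.Quotient.mk Q), RingHom.ext fun b => ?_, ?_⟩
  · change L (Ideal.Quotient.mk Q (algebraMap Bc Rc b)) = ψ b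
    rw [← Ideal.Quotient.algebraMap_mk_of_liesOver (p := 𝔭) (P := Q), AlgHom.commutes]
    rfl
  · change L (Ideal.Quotient.mk Q f) ≠ 0
    rw [Ne, ← map_zero L, hL.eq_iff, Ideal.Quotient.eq_zero_iff_mem]
    exact hfQ

/-! ## The embedding theorem -/

/-- The image in `Rc` of a non-zero constant coefficient: if `f ≠ 0` is integral over `Bc` inside a
domain `Rc`, some `b₀ ≠ 0` in `Bc` satisfies `b₀ ∈ f·Rc` (divide a monic equation of `f` by the
largest power of `X`). [folklore] -/
private theorem exists_ne_zero_mem_span_of_isIntegral {Bc Rc : Type*} [CommRing Bc]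
    [Nontrivial Bc] [CommRing Rc] [Algebra Bc Rc] [IsDomain Rc] {f : Rc} (hf : f ≠ 0)
    (hint : IsIntegral Bc f) :
    ∃ b₀ : Bc, b₀ ≠ 0 ∧ algebraMap Bc Rc b₀ ∈ Ideal.span {f} := by
  obtain ⟨P, hPmonic, hPf⟩ := hint
  have hP0 : P ≠ 0 := hPmonic.ne_zero
  obtain ⟨Q, hPQ, hQ⟩ := Polynomial.exists_eq_pow_rootMultiplicity_mul_and_not_dvd P hP0 0
  rw [map_zero, sub_zero] at hPQ hQ
  have hQ0 : Q.coeff 0 ≠ 0 := fun h => hQ (Polynomial.X_dvd_iff.2 h)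
  have hQf : Polynomial.eval₂ (algebraMap Bc Rc) f Q = 0 := by
    have h1 : Polynomial.eval₂ (algebraMap Bc Rc) f P = 0 := hPf
    rw [hPQ, Polynomial.eval₂_mul, Polynomial.eval₂_X_pow] at h1
    exact (mul_eq_zero.1 h1).resolve_left (pow_ne_zero _ hf)
  refine ⟨Q.coeff 0, hQ0, ?_⟩
  -- `Q = X * Q.divX + C (Q.coeff 0)`, evaluate at `f`
  have h2 : Polynomial.eval₂ (algebraMap Bc Rc) f (Polynomial.X * Q.divX + Polynomial.C (Q.coeff 0))
      = 0 := by rw [Polynomial.X_mul_divX_add]; exact hQf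
  rw [Polynomial.eval₂_add, Polynomial.eval₂_mul, Polynomial.eval₂_X, Polynomial.eval₂_C] at h2
  have h3 : algebraMap Bc Rc (Q.coeff 0) = f * (-Polynomial.eval₂ (algebraMap Bc Rc) f Q.divX) := by
    rw [mul_neg, eq_neg_iff_add_eq_zero, add_comm, h2]
  rw [h3]
  exact Ideal.mul_mem_right _ _ (Ideal.mem_span_singleton_self f)

/-- **Cassels' embedding theorem, Witt-vector form.** Let `R` be an integral domain of characteristic
zero which is finitely generated as a ring. Then there is `N₀` such that for every prime `p ≥ N₀`
and every algebraically closed field `κ` of characteristic `p` (e.g. `𝔽̄_p`), `R` admits an INJECTIVE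
ring homomorphism into the ring of Witt vectors `W(κ)` (for `κ = 𝔽̄_p`: into the ring of integers of
the completion of the maximal unramified extension of `ℚ_p`). This is Cassels 1976, Thm. I ("a
finitely generated extension of `ℚ` embeds in `ℚ_p` for infinitely many `p`", proved by embedding a
finitely generated subring into `ℤ_p`) with `ℤ_p` replaced by `W(κ) ⊇ ℤ_p`, where Cassels' condition
"`H(a, Y)` has a root modulo `p`" on the prime becomes automatic (`κ` is algebraically closed) and
only finitely many primes are excluded. See the module docstring for the proof.
[cite: Cassels1976, Thm. I] -/
theorem exists_injective_ringHom_wittVector (R : Type u) [CommRing R] [IsDomain R] [CharZero R]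
    [Algebra.FiniteType ℤ R] :
    ∃ N₀ : ℕ, ∀ (p : ℕ) [Fact p.Prime], N₀ ≤ p →
      ∀ (κ : Type v) [Field κ] [IsAlgClosed κ] [CharP κ p],
        ∃ φ : R →+* WittVector p κ, Function.Injective φ := by
  classical
  -- Step 1: a finite transcendence basis `t ⊆ R` over `ℤ`; base ring `B = ℤ[t] ⊆ R`
  obtain ⟨s, hs⟩ := Algebra.FiniteType.out (R := ℤ) (A := R)
  have hmem : ∀ x : R, x ∈ Algebra.adjoin ℤ (s : Set R) := fun x => hs ▸ Algebra.mem_top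
  haveI : Algebra.IsAlgebraic (Algebra.adjoin ℤ (s : Set R)) R :=
    ⟨fun x => isAlgebraic_algebraMap (⟨x, hmem x⟩ : Algebra.adjoin ℤ (s : Set R))⟩
  obtain ⟨t, hts, ht⟩ := exists_isTranscendenceBasis_subset (R := ℤ) (A := R) (s : Set R)
  haveI : Finite t := (s.finite_toSet.subset hts).to_subtype
  set B : Subalgebra ℤ R := Algebra.adjoin ℤ (Set.range (Subtype.val : t → R)) with hB
  haveI : Algebra.IsAlgebraic B R := ht.isAlgebraic
  -- `B ≅ ℤ[X_i : i ∈ t]`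
  let e : MvPolynomial t ℤ ≃ₐ[ℤ] B := ht.1.aevalEquiv
  have he : ∀ P : MvPolynomial t ℤ, ((e P : B) : R) = MvPolynomial.aeval (Subtype.val : t → R) P :=
    fun P => rfl
  haveI : IsNoetherianRing B := isNoetherianRing_of_ringEquiv (MvPolynomial t ℤ) e.toRingEquiv
  haveI : Algebra.FiniteType ℤ R := inferInstance
  haveI : Algebra.FiniteType B R := Algebra.FiniteType.of_restrictScalars_finiteType ℤ B R
  -- Step 2: generic finiteness, `R[1/c]` integral over `B[1/c]`
  obtain ⟨c, hc0, hint⟩ := exists_isIntegral_away (B := B) (R := R)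
  have hcR0 : (algebraMap B R c) ≠ 0 := fun h => hc0 (Subtype.val_injective (by simpa using h))
  let Bc := Localization.Away c
  let Rc := Localization.Away (algebraMap B R c)
  haveI : IsDomain Bc :=
    IsLocalization.isDomain_localization (powers_le_nonZeroDivisors_of_noZeroDivisors hc0)
  haveI : IsDomain Rc :=
    IsLocalization.isDomain_localization (powers_le_nonZeroDivisors_of_noZeroDivisors hcR0)
  have hcunit : IsUnit (algebraMap B Rc c) := by
    rw [IsScalarTower.algebraMap_apply B R Rc]
    exact IsLocalization.Away.algebraMap_isUnit (algebraMap B R c)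
  letI : Algebra Bc Rc := (IsLocalization.Away.lift c hcunit).toAlgebra
  haveI : IsScalarTower B Bc Rc := IsScalarTower.of_algebraMap_eq fun b =>
    (IsLocalization.Away.lift_eq c hcunit b).symm
  haveI : Algebra.IsIntegral Bc Rc := hint Bc Rc
  -- injectivity of `Bc → Rc`
  have hBR : Function.Injective (algebraMap B R) := Subtype.val_injective
  have hinjBcRc : Function.Injective (algebraMap Bc Rc) := by
    rw [injective_iff_map_eq_zero]
    intro z hz
    obtain ⟨n, b, hzb⟩ := IsLocalization.Away.surj c z
    have h1 : algebraMap B Rc b = 0 := by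
      rw [IsScalarTower.algebraMap_apply B Bc Rc, ← hzb, map_mul, hz, zero_mul]
    rw [IsScalarTower.algebraMap_apply B R Rc] at h1
    have h2 : algebraMap B R b = 0 := (IsLocalization.injective Rc
      (powers_le_nonZeroDivisors_of_noZeroDivisors hcR0)).eq_iff' (map_zero _) |>.1 h1
    have h3 : b = 0 := hBR.eq_iff' (map_zero _) |>.1 h2
    rw [h3, map_zero] at hzb
    exact (IsUnit.mul_left_eq_zero (IsUnit.pow n (IsLocalization.Away.algebraMap_isUnit c))).1 hzb
  haveI : FaithfulSMul Bc Rc := (faithfulSMul_iff_algebraMap_injective Bc Rc).2 hinjBcRc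
  haveI : CharZero Bc :=
    charZero_of_injective_algebraMap (IsLocalization.injective Bc
      (powers_le_nonZeroDivisors_of_noZeroDivisors hc0))
  haveI : IsNoetherianRing Bc := IsLocalization.isNoetherianRing (Submonoid.powers c) Bc ‹_›
  haveI : Algebra.FiniteType B Rc :=
    Algebra.FiniteType.trans (S := R) inferInstance
      (IsLocalization.finiteType_of_monoid_fg (Submonoid.powers (algebraMap B R c)) Rc)
  haveI : Algebra.FiniteType Bc Rc := Algebra.FiniteType.of_restrictScalars_finiteType B Bc Rc
  -- Step 3: generic étaleness, `Rc[1/f]` étale over `Bc`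
  obtain ⟨f, hf0, het⟩ := exists_etale_away Bc Rc
  let A := Localization.Away f
  -- Step 4: the bad element `b₀ ∈ Bc ∩ f·Rc`, written as `b / c^n`
  obtain ⟨b₀, hb₀0, hb₀f⟩ :=
    exists_ne_zero_mem_span_of_isIntegral hf0 (Algebra.IsIntegral.isIntegral (R := Bc) f)
  obtain ⟨n, b, hb⟩ := IsLocalization.Away.surj c b₀
  have hb0 : b ≠ 0 := by
    intro h
    rw [h, map_zero] at hb
    exact hb₀0 ((IsUnit.mul_left_eq_zero
      (IsUnit.pow n (IsLocalization.Away.algebraMap_isUnit c))).1 hb)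
  -- the bad polynomial `e⁻¹ (c * b)` and one of its non-zero coefficients
  set Pbad : MvPolynomial t ℤ := e.symm (c * b) with hPbad
  have hPbad0 : Pbad ≠ 0 := by
    rw [hPbad, Ne, EmbeddingLike.map_eq_zero_iff]
    exact mul_ne_zero hc0 hb0
  obtain ⟨m₀, hm₀⟩ := MvPolynomial.ne_zero_iff.1 hPbad0
  -- Step 5: the bound
  refine ⟨(MvPolynomial.coeff m₀ Pbad).natAbs + 1, fun p _ hp κ _ _ _ => ?_⟩
  haveI : Fact p.Prime := ‹_›
  haveI : PerfectRing κ p := PerfectField.toPerfectRing p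
  -- `p` does not divide the chosen coefficient
  have hpz : ¬ ((p : ℤ) ∣ MvPolynomial.coeff m₀ Pbad) := by
    intro h
    have h1 : p ∣ (MvPolynomial.coeff m₀ Pbad).natAbs := Int.ofNat_dvd_left.1 h
    have h2 : p ≤ (MvPolynomial.coeff m₀ Pbad).natAbs :=
      Nat.le_of_dvd (Int.natAbs_pos.2 hm₀) h1
    omega
  -- the reduction of `Pbad` to `κ` is non-zero, so has a non-root `a`
  set Pbar : MvPolynomial t κ := MvPolynomial.map (Int.castRingHom κ) Pbad with hPbar
  have hPbar0 : Pbar ≠ 0 := by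
    intro h
    have h1 : MvPolynomial.coeff m₀ Pbar = 0 := by rw [h, MvPolynomial.coeff_zero]
    rw [hPbar, MvPolynomial.coeff_map, eq_intCast, CharP.intCast_eq_zero_iff κ p] at h1
    exact hpz h1
  obtain ⟨a, ha⟩ : ∃ a : t → κ, MvPolynomial.eval a Pbar ≠ 0 := by
    by_contra h
    apply hPbar0
    apply MvPolynomial.funext
    intro a
    rw [map_zero]
    by_contra h'
    exact h ⟨a, h'⟩
  -- Step 6: lift `a` to algebraically independent Witt vectors `u`
  obtain ⟨u, hu, hua⟩ := exists_algebraicIndependent_lift_wittVector p κ t a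
  -- the maps `ψ̄ : B → κ` (`y ↦ a`) and `ψ : B → W(κ)` (`y ↦ u`)
  let ψbar₀ : MvPolynomial t ℤ →+* κ := MvPolynomial.eval₂Hom (Int.castRingHom κ) a
  let ψ₀ : MvPolynomial t ℤ →+* WittVector p κ := (MvPolynomial.aeval u).toRingHom
  have hψ₀inj : Function.Injective ψ₀ := algebraicIndependent_iff_injective_aeval.1 hu
  have hψ₀bar : ∀ P, WittVector.constantCoeff (ψ₀ P) = ψbar₀ P := by
    intro P
    change (WittVector.constantCoeff.comp ψ₀) P = ψbar₀ P
    congr 1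
    refine MvPolynomial.ringHom_ext (fun z => ?_) (fun i => ?_)
    · simp [ψ₀, ψbar₀]
    · simp [ψ₀, ψbar₀, WittVector.constantCoeff_apply, hua i]
  let ψbar : B →+* κ := ψbar₀.comp e.symm.toRingEquiv.toRingHom
  let ψ : B →+* WittVector p κ := ψ₀.comp e.symm.toRingEquiv.toRingHom
  have hψinj : Function.Injective ψ := hψ₀inj.comp e.symm.injective
  have hψbar_ψ : ∀ x : B, WittVector.constantCoeff (ψ x) = ψbar x := fun x => hψ₀bar _
  have hψbarPbad : ψbar (c * b) = MvPolynomial.eval a Pbar := by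
    change ψbar₀ (e.symm (c * b)) = _
    rw [← hPbad, hPbar, MvPolynomial.eval_map]
    rfl
  have hψbar_c : ψbar c ≠ 0 := by
    intro h; apply ha; rw [← hψbarPbad, map_mul, h, zero_mul]
  have hψbar_b : ψbar b ≠ 0 := by
    intro h; apply ha; rw [← hψbarPbad, map_mul, h, mul_zero]
  -- `ψ c` is a unit of `W(κ)`, so `ψ` extends to `ψc : Bc → W(κ)`, injective
  have hψc_unit : IsUnit (ψ c) := by
    refine WittVector.isUnit_of_coeff_zero_ne_zero _ ?_
    rw [← WittVector.constantCoeff_apply, hψbar_ψ]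
    exact hψbar_c
  let ψc : Bc →+* WittVector p κ := IsLocalization.Away.lift c hψc_unit
  have hψc_eq : ∀ x : B, ψc (algebraMap B Bc x) = ψ x := IsLocalization.Away.lift_eq c hψc_unit
  have hψc_inj : Function.Injective ψc := by
    rw [injective_iff_map_eq_zero]
    intro z hz
    obtain ⟨k, x, hzx⟩ := IsLocalization.Away.surj c z
    have h1 : ψ x = 0 := by
      rw [← hψc_eq, ← hzx, map_mul, hz, zero_mul]
    have h2 : x = 0 := (injective_iff_map_eq_zero ψ).1 hψinj x h1
    rw [h2, map_zero] at hzx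
    exact (IsUnit.mul_left_eq_zero (IsUnit.pow k (IsLocalization.Away.algebraMap_isUnit c))).1 hzx
  -- `ψ̄` extends to `ψ̄c : Bc → κ`
  have hψbarc_unit : IsUnit (ψbar c) := isUnit_iff_ne_zero.2 hψbar_c
  let ψbarc : Bc →+* κ := IsLocalization.Away.lift c hψbarc_unit
  have hψbarc_eq : ∀ x : B, ψbarc (algebraMap B Bc x) = ψbar x :=
    IsLocalization.Away.lift_eq c hψbarc_unit
  have hψc_bar : ∀ z : Bc, WittVector.constantCoeff (ψc z) = ψbarc z := by
    intro z
    change (WittVector.constantCoeff.comp ψc) z = ψbarc z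
    congr 1
    refine IsLocalization.ringHom_ext (Submonoid.powers c) (RingHom.ext fun x => ?_)
    simp only [RingHom.comp_apply, hψc_eq, hψbarc_eq, hψbar_ψ]
  -- Step 7: a `κ`-point of `Rc` over `ψ̄c` not killing `f`
  have hψbarc_b₀ : ψbarc b₀ ≠ 0 := by
    intro h
    have h1 : ψbarc (algebraMap B Bc b) = 0 := by rw [← hb, map_mul, h, zero_mul]
    rw [hψbarc_eq] at h1
    exact hψbar_b h1
  obtain ⟨xbar, hxbar, hxbarf⟩ := exists_ringHom_comp_eq_of_isIntegral ψbarc hb₀f hψbarc_b₀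
  -- … which is a `κ`-point of the étale `Bc`-algebra `A = Rc[1/f]`
  let xbarA : A →+* κ := IsLocalization.Away.lift f (isUnit_iff_ne_zero.2 hxbarf)
  have hxbarA : ∀ r : Rc, xbarA (algebraMap Rc A r) = xbar r :=
    IsLocalization.Away.lift_eq f (isUnit_iff_ne_zero.2 hxbarf)
  -- Step 8: Hensel lift of this point to a `Bc`-algebra map `A → W(κ)`
  letI : Algebra Bc (WittVector p κ) := ψc.toAlgebra
  haveI : Algebra.Etale Bc A := het
  have hcompat : ∀ z : Bc, xbarA (algebraMap Bc A z) =
      WittVector.constantCoeff (algebraMap Bc (WittVector p κ) z) := by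
    intro z
    rw [IsScalarTower.algebraMap_apply Bc Rc A, hxbarA, ← RingHom.comp_apply, hxbar]
    exact (hψc_bar z).symm
  obtain ⟨g, -⟩ := exists_algHom_wittVector_of_formallySmooth xbarA hcompat
  -- Step 9: the embedding and its injectivity
  let gR : Rc →+* WittVector p κ := (g : A →+* WittVector p κ).comp (algebraMap Rc A)
  have hgR : Function.Injective gR := by
    haveI : (RingHom.ker gR).IsPrime := RingHom.ker_isPrime gR
    have hker : RingHom.ker gR = ⊥ := by
      refine Ideal.eq_bot_of_comap_eq_bot (R := Bc) ?_
      refine eq_bot_iff.2 fun z hz => ?_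
      rw [Ideal.mem_comap, RingHom.mem_ker] at hz
      change g (algebraMap Rc A (algebraMap Bc Rc z)) = 0 at hz
      rw [← IsScalarTower.algebraMap_apply, AlgHom.commutes] at hz
      exact (Ideal.mem_bot).2 ((injective_iff_map_eq_zero ψc).1 hψc_inj z hz)
    exact (RingHom.injective_iff_ker_eq_bot gR).2 hker
  refine ⟨gR.comp (algebraMap R Rc), hgR.comp ?_⟩
  exact IsLocalization.injective Rc (powers_le_nonZeroDivisors_of_noZeroDivisors hcR0)

end Literature.RingTheory.CompleteLocalRings

end
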